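import Summits.Ventures.PercRepro0.RandomSet

/-!
# Lemma 4.1: the pivotal-bond lower bound (seat p4, block P5 in Lean: S2, part 2)

SHARP-p4-v2 §4, Lemma 4.1 on `Defs`, in the summed form used by the integration step: if `φ_p(A) ≥ 1` for every
finite `A ∋ 0`, then for every box `Λ_n`

  `1 − P_p(0 ↔ ∂Λ_n) ≤ p (1 − p) ∑_{e ∈ E(Λ_n)} P_p(Piv_e(0 ↔ ∂Λ_n))`   (`one_sub_le_mul_sum_piv`).

Steps (on the random set `𝒮` of `RandomSet.lean`):

* **Claim 6** (`sEq_inter_connIn_subset`): for `A ⊆ Λ_n ∖ ∂Λ_n`, `x ∈ A`, `y ∉ A`, `y ∼ x`, on `{𝒮 = A} ∩ {0 ↔_A x}` the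
  bond `{x, y}` is closed and pivotal for `{0 ↔ ∂Λ_n}` (open it: `0 ↔_A x`, then `{x, y}`, then the avoiding path of
  Claim 5 from `y` to `∂Λ_n`; closed it stays: `0 ∈ 𝒮`);
* independence of `{𝒮 = A}` and `{0 ↔_A x}` (F5 on the disjoint bond sets `E(Λ_n) ∖ E(A)` and `E(A)`,
  `P_sEq_inter_connIn`);
* `boxBondsF d n` = `E(Λ_n)` as a finset, `{0 ↔ ∂Λ_n}` is determined by it (`determinedBy_toBoundary_boxBondsF`), the
  pivotal events are measurable;
* the pair sum: `∑_{x ∈ A} |{y ∉ A : y ∼ x}| P({𝒮 = A} ∩ {0 ↔_A x}) ≤ ∑_{e ∈ E(Λ_n)} P({𝒮 = A} ∩ Piv_e ∩ {e closed})`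
  by Claim 6 and the injectivity of `(x, y) ↦ {x, y}` on the pairs `x ∈ A`, `y ∉ A` (`sum_card_mul_P_le`);
* the partition over `A` of the pivotal-and-closed events (`sum_P_sEq_inter_eq`) and
  `P(Piv_e ∩ {e closed}) = (1 − p) P(Piv_e)` (`Russo.P_piv_inter_closed`).

Continued in `Sharpness.lean` (Russo's formula for `θ_n`, the integration step, `P5_Sharpness_holds`).
-/

namespace Summit.Ventures.PercRepro0.Sharp

open MeasureTheory ProbabilityTheory unitInterval Set
open Summit.Ventures.PercRepro0.Defs
open scoped ENNReal Classical

variable {d : ℕ}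

/-! ### Claim 6: on `{𝒮 = A} ∩ {0 ↔_A x}` the bond `{x, y}` is closed and pivotal -/

/-- A neighbour of a point of `Λ_n ∖ ∂Λ_n` lies in `Λ_n`. -/
theorem mem_box_of_adj_of_mem_intF {n : ℕ} {x y : Vertex d} (hx : x ∈ intF d n)
    (hadj : (lattice d).Adj x y) : y ∈ box d n := by
  obtain ⟨hxB, hxb⟩ := mem_intF.1 hx
  intro i
  have h1 := lattice_adj_abs_sub_le hadj i
  have h2 : |x i| ≤ n := hxB i
  have h3 : |x i| ≠ n := fun h => hxb ⟨hxB, i, h⟩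
  have h4 : |y i| ≤ |x i| + |x i - y i| := by
    calc |y i| = |x i - (x i - y i)| := by rw [sub_sub_cancel]
      _ ≤ |x i| + |x i - y i| := abs_sub _ _
  have h5 : |x i| < n := lt_of_le_of_ne h2 h3
  linarith

/-- **Claim 6.** For `A ⊆ Λ_n ∖ ∂Λ_n`, `x ∈ A`, `y ∉ A`, `y ∼ x`: on `{𝒮 = A} ∩ {0 ↔_A x}` the bond `{x, y}` is
closed and pivotal for `{0 ↔ ∂Λ_n}`. -/
theorem sEq_inter_connIn_subset {n : ℕ} {A : Finset (Vertex d)} (hA : A ⊆ intF d n) {x y : Vertex d}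
    (hx : x ∈ A) (hy : y ∈ outNbrs (↑A) x) :
    SEq n A ∩ {ω : Config d | ConnIn (↑A) ω 0 x} ⊆
      Russo.Piv s(x, y) (toBoundary d n) ∩ {ω : Config d | s(x, y) ∉ ω} := by
  rintro ω ⟨hS, hc⟩
  have hc' : ConnIn (↑A) ω 0 x := hc
  obtain ⟨hadj, hyA⟩ := mem_outNbrs.1 hy
  have hb : s(x, y) ∈ bonds d := (lattice d).mem_edgeSet.2 hadj
  have hyB : y ∈ box d n := mem_box_of_adj_of_mem_intF (hA hx) hadj
  obtain ⟨hcut, hconn⟩ := (sEq_iff hA).1 hS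
  have hclosed : s(x, y) ∉ ω := hcut s(x, y)
    ⟨⟨hb, fun v hv => by
        rcases Sym2.mem_iff.1 hv with rfl | rfl
        · exact (mem_intF.1 (hA hx)).1
        · exact hyB⟩,
      ⟨x, Sym2.mem_mk_left x y, hx⟩, ⟨y, Sym2.mem_mk_right x y, hyA⟩⟩
  have h0A : (0 : Vertex d) ∈ A := Finset.mem_coe.1 (mem_of_connIn (Finset.mem_coe.2 hx) (connIn_symm hc'))
  refine ⟨⟨?_, ?_⟩, hclosed⟩
  · obtain ⟨z, hz, hyz⟩ := hconn y hyB hyA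
    refine ⟨z, hz, ?_⟩
    have h1 : Conn d (insert s(x, y) ω) 0 x := conn_mono (Set.subset_insert _ _) (conn_of_connIn hc')
    have h2 : (openGraph d (insert s(x, y) ω)).Adj x y := by
      rw [openGraph, SimpleGraph.fromEdgeSet_adj]
      exact ⟨⟨Set.mem_insert _ _, hb⟩, hadj.ne⟩
    have h3 : Conn d (insert s(x, y) ω) y z := conn_mono (Set.subset_insert _ _) (conn_of_connIn hyz)
    exact h1.trans (h2.reachable.trans h3)
  · rw [Set.sdiff_singleton_eq_self hclosed, toBoundary_eq_toBdry]
    exact (mem_sEq_iff hS (zero_mem_box n)).1 h0A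

/-! ### Independence, the pair sum and the partition over `A` -/

/-- `{𝒮 = A}` and `{0 ↔_A x}` are independent (F5: `E(Λ_n) ∖ E(A)` and `E(A)` are disjoint). -/
theorem P_sEq_inter_connIn {n : ℕ} {A : Finset (Vertex d)} (hA : A ⊆ intF d n) (p : I) (x : Vertex d) :
    P d p (SEq n A ∩ {ω : Config d | ConnIn (↑A) ω 0 x}) =
      P d p (SEq n A) * P d p {ω : Config d | ConnIn (↑A) ω 0 x} := by
  have hmem1 : MeasurableSet[sigmaOn (bondsIn (box d n) \ bondsIn (↑A))] (SEq n A) :=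
    measurableSet_sigmaOn_of_determinedBy ((bondsIn_finite (box_finite n)).subset Set.sdiff_subset)
      (determinedBy_sEq hA)
  have hmem2 : MeasurableSet[sigmaOn (bondsIn (↑A))] {ω : Config d | ConnIn (↑A) ω 0 x} :=
    measurableSet_sigmaOn_of_determinedBy (bondsIn_finite A.finite_toSet) (determinedBy_connIn _ 0 x)
  exact P_inter_eq_mul_of_disjoint p Set.disjoint_sdiff_left hmem1 hmem2

/-- `E(Λ_n)` as a finset. -/
noncomputable def boxBondsF (d n : ℕ) : Finset (Sym2 (Vertex d)) :=
  (bondsIn_finite (box_finite (d := d) n)).toFinset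

/-- Membership in `boxBondsF`. -/
theorem mem_boxBondsF {n : ℕ} {e : Sym2 (Vertex d)} : e ∈ boxBondsF d n ↔ e ∈ bondsIn (box d n) :=
  Set.Finite.mem_toFinset _

/-- `boxBondsF` as a set. -/
theorem coe_boxBondsF (n : ℕ) : (↑(boxBondsF d n) : Set (Sym2 (Vertex d))) = bondsIn (box d n) :=
  Set.Finite.coe_toFinset _

/-- `E(Λ_n)` consists of bonds. -/
theorem boxBondsF_subset_bonds (n : ℕ) : (↑(boxBondsF d n) : Set (Sym2 (Vertex d))) ⊆ bonds d := by
  rw [coe_boxBondsF]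
  exact bondsIn_subset_bonds _

/-- `{0 ↔ ∂Λ_n}` is determined by `E(Λ_n)`. -/
theorem determinedBy_toBoundary_boxBondsF (n : ℕ) :
    DeterminedBy (↑(boxBondsF d n)) (toBoundary d n) := by
  rw [coe_boxBondsF, toBoundary_eq_toBdry]
  intro ω ω' h
  exact toBdry_congr h 0

/-- The pivotal event of `{0 ↔ ∂Λ_n}` is measurable. -/
theorem measurableSet_piv_toBoundary (n : ℕ) (e : Sym2 (Vertex d)) :
    MeasurableSet (Russo.Piv e (toBoundary d n)) :=
  Russo.measurableSet_of_determinedBy ((boxBondsF d n).finite_toSet.subset Set.sdiff_subset)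
    (Russo.determinedBy_piv (determinedBy_toBoundary_boxBondsF n) e)

/-- `{e closed}` is measurable. -/
theorem measurableSet_closed (e : Sym2 (Vertex d)) : MeasurableSet {ω : Config d | e ∉ ω} :=
  (measurableSet_setOf.2 (measurable_set_mem e)).compl

/-- `∑_A P({𝒮 = A} ∩ B) = P(B)` in real form. -/
theorem sum_P_sEq_inter_eq (n : ℕ) (p : I) {B : Set (Config d)} (hB : MeasurableSet B) :
    ∑ A ∈ scands d n, (P d p (SEq n A ∩ B)).toReal = (P d p B).toReal := by
  rw [P_eq_sum_sEq n p hB, ENNReal.toReal_sum fun A _ => measure_ne_top _ _]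

/-- For `A ⊆ Λ_n ∖ ∂Λ_n`:
`∑_{x ∈ A} |{y ∉ A : y ∼ x}| · P({𝒮 = A} ∩ {0 ↔_A x}) ≤ ∑_{e ∈ E(Λ_n)} P({𝒮 = A} ∩ Piv_e ∩ {e closed})`
(Claim 6 and the injectivity of `(x, y) ↦ {x, y}` on the pairs `x ∈ A`, `y ∉ A`). -/
theorem sum_card_mul_P_le {n : ℕ} {A : Finset (Vertex d)} (hA : A ⊆ intF d n) (p : I) :
    ∑ x ∈ A, ((outNbrs (↑A) x).card : ℝ) * (P d p (SEq n A ∩ {ω : Config d | ConnIn (↑A) ω 0 x})).toReal ≤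
      ∑ e ∈ boxBondsF d n,
        (P d p (SEq n A ∩ (Russo.Piv e (toBoundary d n) ∩ {ω : Config d | e ∉ ω}))).toReal := by
  have h1 : ∑ x ∈ A, ((outNbrs (↑A) x).card : ℝ) *
        (P d p (SEq n A ∩ {ω : Config d | ConnIn (↑A) ω 0 x})).toReal =
      ∑ x ∈ A, ∑ y ∈ outNbrs (↑A) x, (P d p (SEq n A ∩ {ω : Config d | ConnIn (↑A) ω 0 x})).toReal := by
    refine Finset.sum_congr rfl fun x _ => ?_
    rw [Finset.sum_const, nsmul_eq_mul]
  have h2 : ∑ x ∈ A, ∑ y ∈ outNbrs (↑A) x, (P d p (SEq n A ∩ {ω : Config d | ConnIn (↑A) ω 0 x})).toReal ≤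
      ∑ x ∈ A, ∑ y ∈ outNbrs (↑A) x,
        (P d p (SEq n A ∩ (Russo.Piv s(x, y) (toBoundary d n) ∩ {ω : Config d | s(x, y) ∉ ω}))).toReal := by
    refine Finset.sum_le_sum fun x hx => Finset.sum_le_sum fun y hy => ?_
    refine ENNReal.toReal_mono (measure_ne_top _ _) (measure_mono ?_)
    exact Set.subset_inter Set.inter_subset_left (sEq_inter_connIn_subset hA hx hy)
  have h3 : ∑ x ∈ A, ∑ y ∈ outNbrs (↑A) x,
        (P d p (SEq n A ∩ (Russo.Piv s(x, y) (toBoundary d n) ∩ {ω : Config d | s(x, y) ∉ ω}))).toReal =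
      ∑ t ∈ A.sigma (fun x => outNbrs (↑A) x),
        (P d p (SEq n A ∩ (Russo.Piv s(t.1, t.2) (toBoundary d n) ∩ {ω : Config d | s(t.1, t.2) ∉ ω}))).toReal :=
    Finset.sum_sigma' A (fun x => outNbrs (↑A) x) fun x y =>
      (P d p (SEq n A ∩ (Russo.Piv s(x, y) (toBoundary d n) ∩ {ω : Config d | s(x, y) ∉ ω}))).toReal
  have hinj : Set.InjOn (fun t : (Σ _ : Vertex d, Vertex d) => s(t.1, t.2))
      ↑(A.sigma fun x => outNbrs (↑A) x) := by
    rintro ⟨x, y⟩ hxy ⟨x', y'⟩ hxy' h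
    rw [Finset.mem_coe, Finset.mem_sigma] at hxy hxy'
    have h' : s(x, y) = s(x', y') := h
    have hyA : y ∉ A := (mem_outNbrs.1 hxy.2).2
    have hx'A : x' ∈ A := hxy'.1
    rcases Sym2.eq_iff.1 h' with ⟨hxx, hyy⟩ | ⟨hxy1, hyx1⟩
    · subst hxx; subst hyy; rfl
    · exfalso
      rw [← hyx1] at hx'A
      exact hyA hx'A
  have h4 : ∑ t ∈ A.sigma (fun x => outNbrs (↑A) x),
        (P d p (SEq n A ∩ (Russo.Piv s(t.1, t.2) (toBoundary d n) ∩ {ω : Config d | s(t.1, t.2) ∉ ω}))).toReal =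
      ∑ e ∈ (A.sigma fun x => outNbrs (↑A) x).image (fun t : (Σ _ : Vertex d, Vertex d) => s(t.1, t.2)),
        (P d p (SEq n A ∩ (Russo.Piv e (toBoundary d n) ∩ {ω : Config d | e ∉ ω}))).toReal :=
    (Finset.sum_image (f := fun e =>
      (P d p (SEq n A ∩ (Russo.Piv e (toBoundary d n) ∩ {ω : Config d | e ∉ ω}))).toReal) hinj).symm
  have h5 : (A.sigma fun x => outNbrs (↑A) x).image (fun t : (Σ _ : Vertex d, Vertex d) => s(t.1, t.2)) ⊆
      boxBondsF d n := by
    intro e he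
    obtain ⟨⟨x, y⟩, hxy, rfl⟩ := Finset.mem_image.1 he
    rw [Finset.mem_sigma] at hxy
    obtain ⟨hadj, -⟩ := mem_outNbrs.1 hxy.2
    rw [mem_boxBondsF]
    refine ⟨(lattice d).mem_edgeSet.2 hadj, fun v hv => ?_⟩
    rcases Sym2.mem_iff.1 hv with rfl | rfl
    · exact (mem_intF.1 (hA hxy.1)).1
    · exact mem_box_of_adj_of_mem_intF (hA hxy.1) hadj
  calc _ = _ := h1
    _ ≤ _ := h2
    _ = _ := h3
    _ = _ := h4
    _ ≤ ∑ e ∈ boxBondsF d n,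
          (P d p (SEq n A ∩ (Russo.Piv e (toBoundary d n) ∩ {ω : Config d | e ∉ ω}))).toReal :=
        Finset.sum_le_sum_of_subset_of_nonneg h5 fun e _ _ => ENNReal.toReal_nonneg

/-! ### Lemma 4.1 -/

/-- **Lemma 4.1 (SHARP-p4-v2 §4), summed form.** If `φ_p(A) ≥ 1` for every finite `A ∋ 0`, then for every `n`,
`1 − P_p(0 ↔ ∂Λ_n) ≤ p (1 − p) ∑_{e ∈ E(Λ_n)} P_p(Piv_e(0 ↔ ∂Λ_n))`. -/
theorem one_sub_le_mul_sum_piv (n : ℕ) (p : I)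
    (hφ : ∀ A : Finset (Vertex d), (0 : Vertex d) ∈ A → 1 ≤ phi A p) :
    1 - (P d p (toBoundary d n)).toReal ≤
      (p : ℝ) * (1 - p) * ∑ e ∈ boxBondsF d n, (P d p (Russo.Piv e (toBoundary d n))).toReal := by
  -- (i)–(ii): `1 − θ_n = P(0 ∈ 𝒮) = ∑_{A ∋ 0} P(𝒮 = A)`
  have hstep1 : 1 - (P d p (toBoundary d n)).toReal =
      ∑ A ∈ (scands d n).filter (fun A => (0 : Vertex d) ∈ A), (P d p (SEq n A)).toReal := by
    have h1 : (P d p (toBoundary d n)ᶜ).toReal = 1 - (P d p (toBoundary d n)).toReal := by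
      rw [prob_compl_eq_one_sub (measurableSet_toBoundary n),
        ENNReal.toReal_sub_of_le prob_le_one ENNReal.one_ne_top, ENNReal.toReal_one]
    rw [← h1, P_compl_toBoundary_eq_sum]
    exact ENNReal.toReal_sum fun A _ => measure_ne_top _ _
  -- (iii)–(iv): `≤ ∑_A P(𝒮 = A) φ_p(A)`
  have hstep2 : ∑ A ∈ (scands d n).filter (fun A => (0 : Vertex d) ∈ A), (P d p (SEq n A)).toReal ≤
      ∑ A ∈ scands d n, (P d p (SEq n A)).toReal * phi A p := by
    calc ∑ A ∈ (scands d n).filter (fun A => (0 : Vertex d) ∈ A), (P d p (SEq n A)).toReal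
        ≤ ∑ A ∈ (scands d n).filter (fun A => (0 : Vertex d) ∈ A), (P d p (SEq n A)).toReal * phi A p := by
          refine Finset.sum_le_sum fun A hA => ?_
          exact le_mul_of_one_le_right ENNReal.toReal_nonneg (hφ A (Finset.mem_filter.1 hA).2)
      _ ≤ ∑ A ∈ scands d n, (P d p (SEq n A)).toReal * phi A p :=
          Finset.sum_le_sum_of_subset_of_nonneg (Finset.filter_subset _ _)
            fun A _ _ => mul_nonneg ENNReal.toReal_nonneg (phi_nonneg A p)
  -- (v): `P(𝒮 = A) φ_p(A) = p ∑_x |{y ∉ A : y ∼ x}| P({𝒮 = A} ∩ {0 ↔_A x})`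
  have hstep3 : ∀ A ∈ scands d n, (P d p (SEq n A)).toReal * phi A p =
      (p : ℝ) * ∑ x ∈ A, ((outNbrs (↑A) x).card : ℝ) *
        (P d p (SEq n A ∩ {ω : Config d | ConnIn (↑A) ω 0 x})).toReal := by
    intro A hA
    unfold phi
    simp only [Finset.mul_sum]
    refine Finset.sum_congr rfl fun x _ => ?_
    rw [P_sEq_inter_connIn (mem_scands.1 hA) p x, ENNReal.toReal_mul]
    ring
  -- (vi)–(vii): `≤ p ∑_e P(Piv_e ∩ {e closed})`
  have hstep4 : ∑ A ∈ scands d n, (P d p (SEq n A)).toReal * phi A p ≤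
      (p : ℝ) * ∑ e ∈ boxBondsF d n,
        (P d p (Russo.Piv e (toBoundary d n) ∩ {ω : Config d | e ∉ ω})).toReal := by
    calc ∑ A ∈ scands d n, (P d p (SEq n A)).toReal * phi A p
        = ∑ A ∈ scands d n, (p : ℝ) * ∑ x ∈ A, ((outNbrs (↑A) x).card : ℝ) *
            (P d p (SEq n A ∩ {ω : Config d | ConnIn (↑A) ω 0 x})).toReal := Finset.sum_congr rfl hstep3
      _ ≤ ∑ A ∈ scands d n, (p : ℝ) * ∑ e ∈ boxBondsF d n,
            (P d p (SEq n A ∩ (Russo.Piv e (toBoundary d n) ∩ {ω : Config d | e ∉ ω}))).toReal := by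
          refine Finset.sum_le_sum fun A hA => mul_le_mul_of_nonneg_left ?_ p.2.1
          exact sum_card_mul_P_le (mem_scands.1 hA) p
      _ = (p : ℝ) * ∑ e ∈ boxBondsF d n, ∑ A ∈ scands d n,
            (P d p (SEq n A ∩ (Russo.Piv e (toBoundary d n) ∩ {ω : Config d | e ∉ ω}))).toReal := by
          rw [← Finset.mul_sum, Finset.sum_comm]
      _ = (p : ℝ) * ∑ e ∈ boxBondsF d n,
            (P d p (Russo.Piv e (toBoundary d n) ∩ {ω : Config d | e ∉ ω})).toReal := by
          congr 1
          refine Finset.sum_congr rfl fun e _ => ?_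
          exact sum_P_sEq_inter_eq n p ((measurableSet_piv_toBoundary n e).inter (measurableSet_closed e))
  -- (viii)–(ix): `P(Piv_e ∩ {e closed}) = (1 − p) P(Piv_e)`
  have hstep5 : ∑ e ∈ boxBondsF d n, (P d p (Russo.Piv e (toBoundary d n) ∩ {ω : Config d | e ∉ ω})).toReal =
      (1 - (p : ℝ)) * ∑ e ∈ boxBondsF d n, (P d p (Russo.Piv e (toBoundary d n))).toReal := by
    rw [Finset.mul_sum]
    refine Finset.sum_congr rfl fun e he => ?_
    exact Russo.P_piv_inter_closed p (boxBondsF_subset_bonds n) (determinedBy_toBoundary_boxBondsF n) he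
  calc 1 - (P d p (toBoundary d n)).toReal = _ := hstep1
    _ ≤ _ := hstep2
    _ ≤ _ := hstep4
    _ = (p : ℝ) * ((1 - (p : ℝ)) * ∑ e ∈ boxBondsF d n, (P d p (Russo.Piv e (toBoundary d n))).toReal) := by
        rw [hstep5]
    _ = _ := by ring

end Summit.Ventures.PercRepro0.Sharp
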